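import Summits.SmoothPoincare4.SmoothPoincare4.Theorems.ConvexBisectionAcyclicBisectionExistsDualHandlePushTube
import HarnessLib

/-!
# Dual handles, XV: the model push in Kosinski's tube is a diffeomorphism near the attaching circle
(brick (PUSH-g) of the sub-goal T3b step (ii) "push the prefix sub-handlebody `X₁` off the cocore
neighbourhood `N` of the suffix handles" of stub `stub_steinRealisation` (NF6), line
`modp-braid-orbits` r11, crux `ConvexBisection.AcyclicBisectionExists`, item
stmt-SmoothPoincare4-10508; wave 3, lead c5, worker Z3)

Sequel of `…DualHandlePushTube.lean`: there `modelPush κ δ ∘ α = tubePush κ δ` near the attaching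
circle `γ = {‖y_λ‖ = 1, y_μ = 0}`, with `tubePush κ δ y = (√(pushP κ (1-s) (‖y_μ‖²/κ²)/s) y_λ, (√δ/κ) y_μ)`
smooth on the open set `tubePushDom κ ∋ γ`.  Here we give its **explicit smooth inverse**

    tubePushInv κ δ x = ( √((1 - pullP κ P (Q/δ))/P) x_λ , (κ/√δ) x_μ ),   P = ‖x_λ‖², Q = ‖x_μ‖²,

smooth on the open set `tubePushInvDom κ δ` containing the circle `C = tubePush (γ)`, and prove that
**`tubePush κ δ : tubePushDom κ → tubePushInvDom κ δ` is a diffeomorphism of open subsets of `ℝ⁴`**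
(`mapsTo_tubePush`, `mapsTo_tubePushInv`, `tubePushInv_tubePush`, `tubePush_tubePushInv`,
`contDiffOn_tubePushInv`).  Consequently the tube-supported global push `sh : X₁ → X₁` of T3b (ii)
is, in the tube chart around `γ`, the restriction of a diffeomorphism of open sets of `ℝ⁴` — smooth
with injective differential AT `γ` — and `jX₁' = Ξ ∘ tubePush` is an immersion there.
(`pullP` is smooth on the larger set `pullDomGe κ = {φ (1 + c) < 1} ⊋ pullDom κ`, which contains the
level `0 = pullP (pFun κ 0)` of `C`; `contDiffOn_pullP_ge`.)  Everything here is proved; no named facts.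

## References
* J. Milnor, *Lectures on the h-cobordism theorem* (1965), §3 (dual handles). [MilnorHCobordism1965]
* A. A. Kosinski, *Differential Manifolds* (1993), VI §6, (6.1). [Kosinski1993]
-/

noncomputable section

-- the prescribed namespace `Summit.<P>.<Sub>.…` duplicates `SmoothPoincare4` (P = Sub)
set_option linter.dupNamespace false

open scoped Manifold ContDiff Topology

namespace Summit.SmoothPoincare4.SmoothPoincare4.Theorems.AcyclicBisectionExists.ModpBraidOrbits

open Set Function Metric
open Literature.Topology.FourManifolds Literature.Topology.FourManifolds.HandleAttachingMap

namespace PushModel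

/-! ### §1 `pullP` on the larger domain `{φ (1 + c) < 1}` -/

section PullGe

variable {κ : ℝ}

/-- The natural domain of `pullP`: `φ(κ²/2 - P') (1 + c(q)) < 1`, i.e. `exp (1/(κ²/2 - P')) > 1 + c(q)`.
[folklore] -/
def pullDomGe (κ : ℝ) : Set (ℝ × ℝ) :=
  {z | expNegInvGlue (κ ^ 2 / 2 - z.1) * (1 + pushShift κ z.2) < 1}

/-- It is open. [folklore] -/
theorem isOpen_pullDomGe (hκ : 0 < κ) : IsOpen (pullDomGe κ) :=
  isOpen_lt (((expNegInvGlue.contDiff (n := 0)).continuous.comp (continuous_const.sub continuous_fst)).mul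
    (continuous_const.add ((contDiff_pushShift hκ).continuous.comp continuous_snd))) continuous_const

/-- The exponential form of membership below `κ²/2`. [folklore] -/
theorem exp_lt_of_mem_pullDomGe {z : ℝ × ℝ} (hz : z ∈ pullDomGe κ) (hP : z.1 < κ ^ 2 / 2) :
    1 + pushShift κ z.2 < Real.exp (1 / (κ ^ 2 / 2 - z.1)) := by
  have hA : 0 < κ ^ 2 / 2 - z.1 := by linarith
  have hφ : expNegInvGlue (κ ^ 2 / 2 - z.1) = (Real.exp (1 / (κ ^ 2 / 2 - z.1)))⁻¹ := by
    rw [expNegInvGlue, if_neg (not_le.2 hA), ← Real.exp_neg, one_div]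
  have h := hz
  rw [pullDomGe, mem_setOf_eq, hφ, inv_mul_lt_iff₀ (Real.exp_pos _), mul_one] at h
  exact h

/-- Membership from the exponential form. [folklore] -/
theorem mem_pullDomGe_of_exp_lt {z : ℝ × ℝ} (hP : z.1 < κ ^ 2 / 2)
    (h : 1 + pushShift κ z.2 < Real.exp (1 / (κ ^ 2 / 2 - z.1))) : z ∈ pullDomGe κ := by
  have hA : 0 < κ ^ 2 / 2 - z.1 := by linarith
  have hφ : expNegInvGlue (κ ^ 2 / 2 - z.1) = (Real.exp (1 / (κ ^ 2 / 2 - z.1)))⁻¹ := by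
    rw [expNegInvGlue, if_neg (not_le.2 hA), ← Real.exp_neg, one_div]
  rw [pullDomGe, mem_setOf_eq, hφ, inv_mul_lt_iff₀ (Real.exp_pos _), mul_one]
  exact h

/-- Levels `P' ≥ κ²/2` belong to it. [folklore] -/
theorem mem_pullDomGe_of_ge {z : ℝ × ℝ} (hP : κ ^ 2 / 2 ≤ z.1) : z ∈ pullDomGe κ := by
  rw [pullDomGe, mem_setOf_eq, expNegInvGlue.zero_of_nonpos (by linarith), zero_mul]; exact one_pos

/-- Every pushed level belongs to it: `(pushP κ P q, q) ∈ pullDomGe κ`. [folklore] -/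
theorem pushP_mem_pullDomGe (hκ : 0 < κ) (P q : ℝ) : (pushP κ P q, q) ∈ pullDomGe κ := by
  rcases lt_or_ge P (κ ^ 2 / 2) with h | h
  · have hm := pushP_mem hκ h (q := q)
    refine mem_pullDomGe_of_exp_lt hm.2 ?_
    have hE1 : 1 < Real.exp (1 / (κ ^ 2 / 2 - P)) := Real.one_lt_exp_iff.2 (by apply one_div_pos.2; linarith)
    have hP' : κ ^ 2 / 2 - pushP κ P q = 1 / Real.log (Real.exp (1 / (κ ^ 2 / 2 - P)) + pushShift κ q) := by
      rw [pushP_eq_of_lt hκ h]; ring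
    show 1 + pushShift κ q < Real.exp (1 / (κ ^ 2 / 2 - pushP κ P q))
    rw [hP', one_div_one_div, Real.exp_log (by linarith [pushShift_nonneg hκ q])]
    linarith
  · exact mem_pullDomGe_of_ge (by rw [pushP_of_ge q h]; exact h)

/-- **`pullP κ` is smooth on `pullDomGe κ`.** [folklore] -/
theorem contDiffOn_pullP_ge (hκ : 0 < κ) : ContDiffOn ℝ ∞ (fun z : ℝ × ℝ => pullP κ z.1 z.2) (pullDomGe κ) := by
  unfold pullP
  have hA : ContDiff ℝ ∞ fun z : ℝ × ℝ => κ ^ 2 / 2 - z.1 := contDiff_const.sub contDiff_fst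
  have hin : ContDiff ℝ ∞ fun z : ℝ × ℝ => 1 - pushShift κ z.2 * expNegInvGlue (κ ^ 2 / 2 - z.1) :=
    contDiff_const.sub (((contDiff_pushShift hκ).comp contDiff_snd).mul (expNegInvGlue.contDiff.comp hA))
  have key : ∀ z ∈ pullDomGe κ, expNegInvGlue (κ ^ 2 / 2 - z.1) <
      1 - pushShift κ z.2 * expNegInvGlue (κ ^ 2 / 2 - z.1) := fun z hz => by
    have h := hz
    rw [pullDomGe, mem_setOf_eq] at h
    nlinarith [expNegInvGlue.nonneg (κ ^ 2 / 2 - z.1), pushShift_nonneg hκ z.2]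
  have hin0 : ∀ z ∈ pullDomGe κ, 0 < 1 - pushShift κ z.2 * expNegInvGlue (κ ^ 2 / 2 - z.1) := fun z hz =>
    lt_of_le_of_lt (expNegInvGlue.nonneg _) (key z hz)
  have hlog : ContDiffOn ℝ ∞ (fun z : ℝ × ℝ => Real.log (1 - pushShift κ z.2 * expNegInvGlue (κ ^ 2 / 2 - z.1)))
      (pullDomGe κ) := hin.contDiffOn.log fun z hz => (hin0 z hz).ne'
  have hden0 : ∀ z ∈ pullDomGe κ, 0 < 1 + (κ ^ 2 / 2 - z.1) *
      Real.log (1 - pushShift κ z.2 * expNegInvGlue (κ ^ 2 / 2 - z.1)) := fun z hz => by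
    rcases le_or_gt (κ ^ 2 / 2 - z.1) 0 with h | h
    · rw [expNegInvGlue.zero_of_nonpos h, mul_zero, sub_zero, Real.log_one, mul_zero, add_zero]
      exact one_pos
    · have hφ : expNegInvGlue (κ ^ 2 / 2 - z.1) = Real.exp (-(κ ^ 2 / 2 - z.1)⁻¹) := by
        rw [expNegInvGlue, if_neg (not_le.2 h)]
      have hlt : -(κ ^ 2 / 2 - z.1)⁻¹ < Real.log (1 - pushShift κ z.2 * expNegInvGlue (κ ^ 2 / 2 - z.1)) :=
        (Real.lt_log_iff_exp_lt (hin0 z hz)).2 (by rw [← hφ]; exact key z hz)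
      have := mul_lt_mul_of_pos_left hlt h
      rw [mul_neg, mul_inv_cancel₀ h.ne'] at this
      linarith
  exact contDiffOn_const.sub (hA.contDiffOn.div (contDiffOn_const.add (hA.contDiffOn.mul hlog))
    fun z hz => (hden0 z hz).ne')

end PullGe

/-! ### §2 The inverse of the push in the tube -/

section TubeInv

variable {κ δ : ℝ}

/-- **The inverse in tube coordinates** `( √((1 - pullP κ P (Q/δ))/P) x_λ , (κ/√δ) x_μ )`. [folklore] -/
def tubePushInv (κ δ : ℝ) (x : EuclideanSpace ℝ (Fin 4)) : EuclideanSpace ℝ (Fin 4) :=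
  torusScale (Real.sqrt ((1 - pullP κ (sOf x) (muN x / δ)) / sOf x)) (κ / Real.sqrt δ) x

/-- Its domain `{(P, Q/δ) ∈ pullDomGe, pullP κ P (Q/δ) < 1, 0 < P}`. [folklore] -/
def tubePushInvDom (κ δ : ℝ) : Set (EuclideanSpace ℝ (Fin 4)) :=
  {x | (sOf x, muN x / δ) ∈ pullDomGe κ ∧ pullP κ (sOf x) (muN x / δ) < 1 ∧ 0 < sOf x}

/-- The domain is open. [folklore] -/
theorem isOpen_tubePushInvDom (hκ : 0 < κ) (δ : ℝ) : IsOpen (tubePushInvDom κ δ) := by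
  have hpq : Continuous fun x : EuclideanSpace ℝ (Fin 4) => (sOf x, muN x / δ) :=
    contDiff_sOf.continuous.prodMk (contDiff_muN.div_const δ).continuous
  have h1 : IsOpen {x : EuclideanSpace ℝ (Fin 4) | (sOf x, muN x / δ) ∈ pullDomGe κ} :=
    (isOpen_pullDomGe hκ).preimage hpq
  have h2 : ContinuousOn (fun x : EuclideanSpace ℝ (Fin 4) => pullP κ (sOf x) (muN x / δ))
      {x | (sOf x, muN x / δ) ∈ pullDomGe κ} :=
    (contDiffOn_pullP_ge hκ).continuousOn.comp hpq.continuousOn fun x hx => hx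
  have h12 : IsOpen {x : EuclideanSpace ℝ (Fin 4) | (sOf x, muN x / δ) ∈ pullDomGe κ ∧
      pullP κ (sOf x) (muN x / δ) < 1} := by
    exact h2.isOpen_inter_preimage h1 isOpen_Iio (t := Iio 1)
  rw [show tubePushInvDom κ δ = {x | (sOf x, muN x / δ) ∈ pullDomGe κ ∧ pullP κ (sOf x) (muN x / δ) < 1} ∩
      {x | 0 < sOf x} by ext x; simp only [tubePushInvDom, mem_setOf_eq, mem_inter_iff, and_assoc]]
  exact h12.inter (isOpen_lt continuous_const contDiff_sOf.continuous)

/-- **The circle `C = {x_μ = 0, ‖x_λ‖² = pFun κ 0}` (the image of `γ`) lies in the domain.**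
[folklore] -/
theorem circle_subset_tubePushInvDom (hκ : 0 < κ) :
    {x : EuclideanSpace ℝ (Fin 4) | muPart x = 0 ∧ sOf x = pFun κ 0} ⊆ tubePushInvDom κ δ := by
  rintro x ⟨h1, h2⟩
  have hm : muN x = 0 := by rw [muN, h1, norm_zero]; ring
  have hb := pushP_base hκ 0
  rw [mul_zero] at hb
  simp only [tubePushInvDom, mem_setOf_eq, hm, zero_div, h2, ← hb]
  exact ⟨pushP_mem_pullDomGe hκ 0 0, by rw [pullP_pushP hκ]; exact one_pos,
    by rw [hb]; exact pFun_pos hκ le_rfl⟩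

/-- **`tubePushInv κ δ` is smooth on `tubePushInvDom κ δ`.** [folklore] -/
theorem contDiffOn_tubePushInv (hκ : 0 < κ) (δ : ℝ) : ContDiffOn ℝ ∞ (tubePushInv κ δ) (tubePushInvDom κ δ) := by
  have hpq : ContDiff ℝ ∞ fun x : EuclideanSpace ℝ (Fin 4) => (sOf x, muN x / δ) :=
    contDiff_sOf.prodMk (contDiff_muN.div_const δ)
  have hpull : ContDiffOn ℝ ∞ (fun x => pullP κ (sOf x) (muN x / δ)) (tubePushInvDom κ δ) :=
    (contDiffOn_pullP_ge hκ).comp hpq.contDiffOn fun x hx => hx.1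
  refine contDiffOn_torusScale (ContDiffOn.sqrt ?_ fun x hx => ?_) contDiffOn_const
  · exact (contDiffOn_const.sub hpull).div contDiff_sOf.contDiffOn fun x hx => hx.2.2.ne'
  · exact (div_pos (by linarith [hx.2.1]) hx.2.2).ne'

/-- `P (tubePush y) = pushP κ (1 - s) (‖y_μ‖²/κ²)` on `tubePushDom`. [folklore] -/
theorem sOf_tubePush {y : EuclideanSpace ℝ (Fin 4)} (hy : y ∈ tubePushDom κ) :
    sOf (tubePush κ δ y) = pushP κ (1 - sOf y) (muN y / κ ^ 2) := by
  have hs := sOf_pos_iff.2 hy.1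
  rw [sOf, tubePush, lamPart_torusScale, norm_sqrt_smul_sq (div_pos hy.2 hs).le, ← sOf, div_mul_cancel₀ _ hs.ne']

/-- `Q (tubePush y) = (δ/κ²) ‖y_μ‖²`. [folklore] -/
theorem muN_tubePush (hκ : 0 < κ) (hδ : 0 < δ) (y : EuclideanSpace ℝ (Fin 4)) :
    muN (tubePush κ δ y) = δ / κ ^ 2 * muN y := by
  rw [muN, tubePush, muPart_torusScale, norm_smul, mul_pow, Real.norm_of_nonneg (by positivity), div_pow,
    Real.sq_sqrt hδ.le, muN]

/-- **`tubePush` maps `tubePushDom` into `tubePushInvDom`.** [folklore] -/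
theorem mapsTo_tubePush (hκ : 0 < κ) (hδ : 0 < δ) : MapsTo (tubePush κ δ) (tubePushDom κ) (tubePushInvDom κ δ) := by
  intro y hy
  have hs := sOf_pos_iff.2 hy.1
  have hq : δ / κ ^ 2 * muN y / δ = muN y / κ ^ 2 := by field_simp
  simp only [tubePushInvDom, mem_setOf_eq, sOf_tubePush hy, muN_tubePush hκ hδ, hq, pullP_pushP hκ]
  exact ⟨pushP_mem_pullDomGe hκ _ _, by linarith, hy.2⟩

/-- **`tubePushInv ∘ tubePush = id` on `tubePushDom`.** [folklore] -/
theorem tubePushInv_tubePush (hκ : 0 < κ) (hδ : 0 < δ) {y : EuclideanSpace ℝ (Fin 4)} (hy : y ∈ tubePushDom κ) :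
    tubePushInv κ δ (tubePush κ δ y) = y := by
  have hs := sOf_pos_iff.2 hy.1
  have hq : δ / κ ^ 2 * muN y / δ = muN y / κ ^ 2 := by field_simp
  set P' := pushP κ (1 - sOf y) (muN y / κ ^ 2) with hP'd
  rw [tubePushInv, sOf_tubePush hy, muN_tubePush hκ hδ, hq, pullP_pushP hκ, sub_sub_cancel, ← hP'd]
  conv_lhs => rw [tubePush, ← hP'd, torusScale_torusScale]
  rw [← Real.sqrt_mul (div_pos hs hy.2).le, div_mul_div_comm, mul_comm, div_self (mul_pos hy.2 hs).ne',
    Real.sqrt_one, div_mul_div_comm, mul_comm κ, div_self (mul_pos (Real.sqrt_pos.2 hδ) hκ).ne', torusScale_one_one]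

/-- `P (tubePushInv x) = 1 - pullP κ P (Q/δ)` on the domain. [folklore] -/
theorem sOf_tubePushInv {x : EuclideanSpace ℝ (Fin 4)} (hx : x ∈ tubePushInvDom κ δ) :
    sOf (tubePushInv κ δ x) = 1 - pullP κ (sOf x) (muN x / δ) := by
  rw [sOf, tubePushInv, lamPart_torusScale, norm_sqrt_smul_sq (div_pos (by linarith [hx.2.1]) hx.2.2).le, ← sOf,
    div_mul_cancel₀ _ hx.2.2.ne']

/-- `Q (tubePushInv x) = (κ²/δ) Q`. [folklore] -/
theorem muN_tubePushInv (hκ : 0 < κ) (hδ : 0 < δ) (x : EuclideanSpace ℝ (Fin 4)) :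
    muN (tubePushInv κ δ x) = κ ^ 2 / δ * muN x := by
  rw [muN, tubePushInv, muPart_torusScale, norm_smul, mul_pow, Real.norm_of_nonneg (by positivity), div_pow,
    Real.sq_sqrt hδ.le, muN]

/-- **`tubePush ∘ tubePushInv = id` on `tubePushInvDom`.** [folklore] -/
theorem tubePush_tubePushInv (hκ : 0 < κ) (hδ : 0 < δ) {x : EuclideanSpace ℝ (Fin 4)}
    (hx : x ∈ tubePushInvDom κ δ) : tubePush κ δ (tubePushInv κ δ x) = x := by
  obtain ⟨h1, h2, hP⟩ := hx
  set P₀ := pullP κ (sOf x) (muN x / δ) with hP₀d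
  have hs : 0 < 1 - P₀ := by linarith
  have hq : κ ^ 2 / δ * muN x / κ ^ 2 = muN x / δ := by field_simp
  have hpush : pushP κ P₀ (muN x / δ) = sOf x :=
    pushP_pullP hκ fun h => exp_lt_of_mem_pullDomGe h1 h
  rw [tubePush, sOf_tubePushInv ⟨h1, h2, hP⟩, muN_tubePushInv hκ hδ, hq, ← hP₀d, sub_sub_cancel, hpush]
  conv_lhs => rw [tubePushInv, ← hP₀d, torusScale_torusScale]
  rw [← Real.sqrt_mul (div_pos hP hs).le, div_mul_div_comm, mul_comm, div_self (mul_pos hs hP).ne', Real.sqrt_one,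
    div_mul_div_comm, mul_comm (Real.sqrt δ), div_self (mul_pos hκ (Real.sqrt_pos.2 hδ)).ne', torusScale_one_one]

/-- **`tubePushInv` maps `tubePushInvDom` into `tubePushDom`.** [folklore] -/
theorem mapsTo_tubePushInv (hκ : 0 < κ) (hδ : 0 < δ) :
    MapsTo (tubePushInv κ δ) (tubePushInvDom κ δ) (tubePushDom κ) := by
  intro x hx
  have hs : 0 < 1 - pullP κ (sOf x) (muN x / δ) := by linarith [hx.2.1]
  have hq : κ ^ 2 / δ * muN x / κ ^ 2 = muN x / δ := by field_simp
  refine ⟨sOf_pos_iff.1 (by rw [sOf_tubePushInv hx]; exact hs), ?_⟩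
  rw [sOf_tubePushInv hx, muN_tubePushInv hκ hδ, hq, sub_sub_cancel,
    pushP_pullP hκ fun h => exp_lt_of_mem_pullDomGe hx.1 h]
  exact hx.2.2

/-- The image of `tubePushDom` is exactly `tubePushInvDom`. [folklore] -/
theorem image_tubePush (hκ : 0 < κ) (hδ : 0 < δ) : tubePush κ δ '' tubePushDom κ = tubePushInvDom κ δ :=
  Subset.antisymm (mapsTo_tubePush hκ hδ).image_subset fun x hx =>
    ⟨tubePushInv κ δ x, mapsTo_tubePushInv hκ hδ hx, tubePush_tubePushInv hκ hδ hx⟩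

end TubeInv

end PushModel

/-- **Registered helper `helper_tubePush_diffeo` (brick (PUSH-g) of T3b (ii), sub-goal of NF6
`stub_steinRealisation`, wave 3, lead c5): in Kosinski's tube around the attaching circle `γ`, the
model push `tubePush κ δ` (`= modelPush κ δ ∘ α` off `γ`) is a diffeomorphism of the open set
`tubePushDom κ ∋ γ` onto the open set `tubePushInvDom κ δ`, with explicit smooth inverse
`tubePushInv κ δ`** — so the globalised push is smooth with injective differential across `γ`.
[folklore] -/
theorem helper_tubePush_diffeo : ∀ {κ δ : ℝ}, 0 < κ → 0 < δ → IsOpen (Summit.SmoothPoincare4.SmoothPoincare4.Theorems.AcyclicBisectionExists.ModpBraidOrbits.PushModel.tubePushDom κ) ∧ IsOpen (Summit.SmoothPoincare4.SmoothPoincare4.Theorems.AcyclicBisectionExists.ModpBraidOrbits.PushModel.tubePushInvDom κ δ) ∧ {y : EuclideanSpace ℝ (Fin 4) | ‖Literature.Topology.FourManifolds.lamPart y‖ = 1 ∧ Literature.Topology.FourManifolds.muPart y = 0} ⊆ Summit.SmoothPoincare4.SmoothPoincare4.Theorems.AcyclicBisectionExists.ModpBraidOrbits.PushModel.tubePushDom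 κ ∧ ContDiffOn ℝ ∞ (Summit.SmoothPoincare4.SmoothPoincare4.Theorems.AcyclicBisectionExists.ModpBraidOrbits.PushModel.tubePush κ δ) (Summit.SmoothPoincare4.SmoothPoincare4.Theorems.AcyclicBisectionExists.ModpBraidOrbits.PushModel.tubePushDom κ) ∧ ContDiffOn ℝ ∞ (Summit.SmoothPoincare4.SmoothPoincare4.Theorems.AcyclicBisectionExists.ModpBraidOrbits.PushModel.tubePushInv κ δ) (Summit.SmoothPoincare4.SmoothPoincare4.Theorems.AcyclicBisectionExists.ModpBraidOrbits.PushModel.tubePushInvDom κ δ) ∧ Summit.SmoothPoincare4.SmoothPoincare4.Theorems.AcyclicBisectionExists.ModpBraidOrbits.PushModel.tubePush κ δ '' Summit.SmoothPoincare4.SmoothPoincare4.Theorems.AcyclicBisectionExists.ModpBraidOrbits.PushModel.tubePushDom κ = Summit.SmoothPoincare4.SmoothPoincare4.Theorems.AcyclicBisectionExists.ModpBraidOrbits.PushModel.tubePushInvDom κ δ ∧ (∀ y ∈ Summit.SmoothPoincare4.SmoothPoincare4.Theorems.AcyclicBisectionExists.ModpBraidOrbits.PushModel.tubePushDom κ,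 Summit.SmoothPoincare4.SmoothPoincare4.Theorems.AcyclicBisectionExists.ModpBraidOrbits.PushModel.tubePushInv κ δ (Summit.SmoothPoincare4.SmoothPoincare4.Theorems.AcyclicBisectionExists.ModpBraidOrbits.PushModel.tubePush κ δ y) = y) ∧ (∀ x ∈ Summit.SmoothPoincare4.SmoothPoincare4.Theorems.AcyclicBisectionExists.ModpBraidOrbits.PushModel.tubePushInvDom κ δ, Summit.SmoothPoincare4.SmoothPoincare4.Theorems.AcyclicBisectionExists.ModpBraidOrbits.PushModel.tubePush κ δ (Summit.SmoothPoincare4.SmoothPoincare4.Theorems.AcyclicBisectionExists.ModpBraidOrbits.PushModel.tubePushInv κ δ x) = x) := by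
  intro κ δ hκ hδ
  exact ⟨PushModel.isOpen_tubePushDom hκ, PushModel.isOpen_tubePushInvDom hκ δ, PushModel.circle_subset_tubePushDom hκ,
    PushModel.contDiffOn_tubePush hκ δ, PushModel.contDiffOn_tubePushInv hκ δ, PushModel.image_tubePush hκ hδ,
    fun y hy => PushModel.tubePushInv_tubePush hκ hδ hy, fun x hx => PushModel.tubePush_tubePushInv hκ hδ hx⟩

end Summit.SmoothPoincare4.SmoothPoincare4.Theorems.AcyclicBisectionExists.ModpBraidOrbits

end
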